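import Summits.BirchSwinnertonDyer.BirchSwinnertonDyer.Theorems.BiquadraticEisensteinDescentEisensteinHeartFlatCMInertBadKPrimeSqrtEndomorphismTwist
import Summits.BirchSwinnertonDyer.BirchSwinnertonDyer.Theorems.BiquadraticEisensteinDescentEisensteinHeartFlatCMInertBadKPrimeBiquadraticPrimes
import Summits.BirchSwinnertonDyer.BirchSwinnertonDyer.Theorems.BiquadraticEisensteinDescentEisensteinHeartFlatCMInertBadKPrimeCMDatumAdapter
import HarnessLib

set_option linter.dupNamespace false -- `Summit.BirchSwinnertonDyer.BirchSwinnertonDyer.Theorems.…` (summit = sub)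
set_option autoImplicit false

/-!
# Crux `EisensteinHeartFlatCMInertBadKPrime` (stmt-BirchSwinnertonDyer-21341), line `hsieh-lambda`, skeleton v2.1:
# stub `stub_sqrtEndomorphism` CLOSED on the seven CM `j`-invariants with a twist certificate — helper

Route `BiquadraticEisensteinDescent` (cell `pub/bsd-wall`, lead-prover seat `bsd-wall-cm-bed-p1` g0, cycle 2). Skeleton v2.1
(stubs `stub_hsiehWitness` / `stub_sqrtEndomorphism` / `stub_V4`): the second stub asks, for `W/ℚ` CM with `p ≥ 5` CM-inert and bad and
two distinct primes `𝔭 ≠ 𝔭′ ∋ p` of the Heegner field `K = K′`, for the CM endomorphism `ψ = [√d₀]` of `W(K̄′)` in Galois-action form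
(`σ ∘ ψ = ±ψ ∘ σ` by the sign `σ(√d₀)/√d₀`, `ψ² = d₀`), a root `r = √d₀ ∈ K̄′ ∖ K′` and `d₀` a non-square mod `p`. This file ASSEMBLES it,
for the seven `j` with an available twist certificate (`j ∈ {−3375, 16581375, −32768, −884736, −884736000, −147197952000,
−262537412640768000}`, `d₀ = d_{K_CM} ∈ {−7, −7, −11, −19, −43, −67, −163}`), from width seat w1 g5's
`…SqrtEndomorphismTwist.exists_sqrt_endomorphism_of_j_mem`, w2 g6's `…BiquadraticPrimes.not_isSquare_of_cmInert` /
`not_exists_sq_eq_of_split` (two distinct primes above `p` in a quadratic `K′` ⇒ `√d₀ ∉ K′` when `d₀` is a non-square mod `p`) and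
w1 g5's `…CMDatumAdapter.exists_smul_eq_neg`. OPEN part of the stub: `j ∈ {0, 1728, 54000, −12288000, 287496, 8000}`.
THEOREMS ONLY; imports no `Theses` module; nothing about `stub_V4` or any case of BSD is asserted. Supports stmt-BirchSwinnertonDyer-21341
as a helper (the stub itself needs all thirteen `j`).
-/

noncomputable section

open scoped Classical NumberField

open WeierstrassCurve NumberField IsDedekindDomain Field
  Literature.NumberTheory.EllipticCurves Literature.NumberTheory.EllipticCurves.Rank1Residual
  Summit.BirchSwinnertonDyer.BirchSwinnertonDyer.Theorems.BiquadraticEisensteinDescentEisensteinHeartFlatCMInertBadKPrimeSqrtEndomorphismTwist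
  Summit.BirchSwinnertonDyer.BirchSwinnertonDyer.Theorems.BiquadraticEisensteinDescentEisensteinHeartFlatCMInertBadKPrimeBiquadraticPrimes
  Summit.BirchSwinnertonDyer.BirchSwinnertonDyer.Theorems.BiquadraticEisensteinDescentEisensteinHeartFlatCMInertBadKPrimeCMDatumAdapter

namespace Summit.BirchSwinnertonDyer.BirchSwinnertonDyer.Theorems.BiquadraticEisensteinDescentEisensteinHeartFlatCMInertBadKPrimeSqrtEndomorphismOfJMem

/-- A square in `ZMod p` in `PadicInt.toZMod` form: `¬ IsSquare (d : ZMod p)` ⟹ `∀ y, y * y ≠ toZMod (d : ℤ_p)`. [folklore] -/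
theorem forall_mul_self_ne_toZMod_of_not_isSquare {p : ℕ} [Fact p.Prime] {d : ℤ}
    (hd : ¬ IsSquare ((d : ℤ) : ZMod p)) : ∀ y : ZMod p, y * y ≠ PadicInt.toZMod ((d : ℤ) : ℤ_[p]) := by
  intro y hy
  rw [map_intCast] at hy
  exact hd ⟨y, hy.symm⟩

/-- **`stub_sqrtEndomorphism` of skeleton v2.1 on the seven certified `j`-invariants.** For `W/ℚ` with
`W.j ∈ {−3375, 16581375, −32768, −884736, −884736000, −147197952000, −262537412640768000}`, `p ≠ 2` CM-inert for `W`, a number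
field `K` of degree `2` with two distinct primes `𝔭 ≠ 𝔭′` above `p`: the Galois-action CM datum `(d₀ = d_{K_CM}, r = √d₀ ∉ K, ψ)`
with `d₀` a non-square mod `p`. [cite: SilvermanAdvancedTopics1994, II §2, Thm. II.2.2(b)] -/
theorem sqrtEndomorphism_datum_of_j_mem (W : WeierstrassCurve ℚ) [W.IsElliptic] {p : ℕ} [Fact p.Prime] (hp2 : p ≠ 2)
    (hj : W.j = -3375 ∨ W.j = 16581375 ∨ W.j = -32768 ∨ W.j = -884736 ∨ W.j = -884736000 ∨ W.j = -147197952000 ∨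
      W.j = -262537412640768000)
    (hin : CMInert W p) (K : Type) [Field K] [NumberField K] (h2K : Module.finrank ℚ K = 2)
    {𝔭 𝔭' : HeightOneSpectrum (𝓞 K)} (h𝔭 : ((p : ℕ) : 𝓞 K) ∈ 𝔭.asIdeal) (h𝔭' : ((p : ℕ) : 𝓞 K) ∈ 𝔭'.asIdeal)
    (hne : 𝔭' ≠ 𝔭) :
    ∃ (d₀ : ℤ) (r : AlgebraicClosure K) (ψ : (W.baseChange K).geomPoints →+ (W.baseChange K).geomPoints),
      r * r = algebraMap K (AlgebraicClosure K) (d₀ : K) ∧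
      r ∉ Set.range (algebraMap K (AlgebraicClosure K)) ∧
      (∀ y : ZMod p, y * y ≠ PadicInt.toZMod ((d₀ : ℤ) : ℤ_[p])) ∧
      (∀ σ : absoluteGaloisGroup K, σ • r = r → ∀ P : (W.baseChange K).geomPoints, σ • ψ P = ψ (σ • P)) ∧
      (∀ σ : absoluteGaloisGroup K, σ • r = -r → ∀ P : (W.baseChange K).geomPoints, σ • ψ P = -ψ (σ • P)) ∧
      (∀ P, ψ (ψ P) = d₀ • P) := by
  set d₀ : ℤ := cmFieldDiscrOfJ W.j with hd₀
  have hdsq : ¬ IsSquare ((d₀ : ℤ) : ZMod p) := not_isSquare_of_cmInert hp2 hin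
  -- `√d₀ ∉ K`: `p` splits in `K` (two distinct primes) but `d₀` is a non-square mod `p`
  have hK : ¬ ∃ y : K, y ^ 2 = (d₀ : K) := not_exists_sq_eq_of_split h2K hdsq h𝔭' h𝔭 hne
  -- a square root in `K̄`
  obtain ⟨r, hr⟩ := IsAlgClosed.exists_eq_mul_self (algebraMap K (AlgebraicClosure K) (d₀ : K))
  have hr' : r * r = algebraMap K (AlgebraicClosure K) (d₀ : K) := hr.symm
  have hr2 : r ^ 2 = algebraMap K (AlgebraicClosure K) ((cmFieldDiscrOfJ W.j : ℤ) : K) := by rw [← hd₀, sq, hr']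
  have hrK : r ∉ Set.range (algebraMap K (AlgebraicClosure K)) := by
    rintro ⟨y, hy⟩
    apply hK
    refine ⟨y, (algebraMap K (AlgebraicClosure K)).injective ?_⟩
    rw [map_pow, hy, sq, hr', map_intCast]
  have hd0 : (d₀ : ℤ) ≠ 0 := by
    intro h0
    apply hdsq
    rw [h0]
    exact ⟨0, by simp⟩
  have hr0 : r ≠ 0 := by
    intro h0
    rw [h0, mul_zero] at hr'
    have : ((d₀ : ℤ) : K) = 0 := by
      have h1 : algebraMap K (AlgebraicClosure K) (d₀ : K) = 0 := hr'.symm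
      exact (map_eq_zero _).mp h1
    exact hd0 (by exact_mod_cast this)
  -- an automorphism moving `r`
  obtain ⟨σ₀, hσ₀⟩ := exists_smul_eq_neg r (d₀ : K) hr' hrK
  -- the CM endomorphism from the twist certificate
  obtain ⟨ψ, hψU, hψU', hψ2⟩ := exists_sqrt_endomorphism_of_j_mem W hj r hr2 hr0 σ₀ hσ₀
  refine ⟨d₀, r, ψ, hr', hrK, forall_mul_self_ne_toZMod_of_not_isSquare hdsq, hψU, hψU', fun P ↦ ?_⟩
  rw [hψ2 P]

/-- **The registered stub's shape on the seven certified `j`** (crux binders `HasCM`, `5 ≤ p`, `CMInert`, `¬ Good`, `K′` imaginary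
quadratic Heegner, `𝔭 ≠ 𝔭′ ∋ p`), i.e. `stub_sqrtEndomorphism` restricted by the hypothesis `hj`. The binders `HasCM`, `¬ Good` and
the Heegner hypothesis are idle here. [cite: SilvermanAdvancedTopics1994, II §2, Thm. II.2.2(b)] -/
theorem stub_sqrtEndomorphism_of_j_mem (W : WeierstrassCurve ℚ) [W.IsElliptic] [W.IsGloballyMinimal] (p : ℕ) [Fact p.Prime]
    [NeZero (W.conductorNorm ℤ)] (K : Type) [Field K] [NumberField K]
    (hj : W.j = -3375 ∨ W.j = 16581375 ∨ W.j = -32768 ∨ W.j = -884736 ∨ W.j = -884736000 ∨ W.j = -147197952000 ∨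
      W.j = -262537412640768000) :
    W.HasCM → 5 ≤ p → CMInert W p → ¬ Good W p →
      IsImaginaryQuadratic K → SatisfiesHeegnerHypothesis (W.conductorNorm ℤ) K →
      ∀ (𝔭 𝔭' : HeightOneSpectrum (𝓞 K)), ((p : ℕ) : 𝓞 K) ∈ 𝔭.asIdeal → ((p : ℕ) : 𝓞 K) ∈ 𝔭'.asIdeal → 𝔭' ≠ 𝔭 →
      ∃ (d₀ : ℤ) (r : AlgebraicClosure K) (ψ : (W.baseChange K).geomPoints →+ (W.baseChange K).geomPoints),
        r * r = algebraMap K (AlgebraicClosure K) (d₀ : K) ∧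
        r ∉ Set.range (algebraMap K (AlgebraicClosure K)) ∧
        (∀ y : ZMod p, y * y ≠ PadicInt.toZMod ((d₀ : ℤ) : ℤ_[p])) ∧
        (∀ σ : absoluteGaloisGroup K, σ • r = r → ∀ P : (W.baseChange K).geomPoints, σ • ψ P = ψ (σ • P)) ∧
        (∀ σ : absoluteGaloisGroup K, σ • r = -r → ∀ P : (W.baseChange K).geomPoints, σ • ψ P = -ψ (σ • P)) ∧
        (∀ P, ψ (ψ P) = d₀ • P) := by
  intro _ hp5 hin _ hK _ 𝔭 𝔭' h𝔭 h𝔭' hne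
  have hp2 : p ≠ 2 := by omega
  exact sqrtEndomorphism_datum_of_j_mem W hp2 hj hin K hK.1 h𝔭 h𝔭' hne

end Summit.BirchSwinnertonDyer.BirchSwinnertonDyer.Theorems.BiquadraticEisensteinDescentEisensteinHeartFlatCMInertBadKPrimeSqrtEndomorphismOfJMem

end
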